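import Summits.QuantumFields.YangMills.Theorems.LuscherReductionDressedRitzPolyakovLiftTransplant
import HarnessLib

/-!
# EXPLICIT SUP OF THE TRANSPLANT OBSERVABLE FROM A GROUND-STATE FLOOR (F9 layer D3 input «Q1-bound on C_f» for S-PSCAL″ of crux `DressedRitz`,
# stmt-QuantumFields-20205, line «polyakovlift» r7; seat ym-20205-polyakovlift-w1a g1; helper `--supports`)

`transplantFn R f i = χ_R · f_{i+1}/f_0` (tree `…PolyakovLiftTransplant`).  Given a pointwise bound `|f_{i+1}| ≤ C_{i+1}` and a FLOOR `m ≤ f_0` on the support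
`‖y‖² < 2R²` of `χ_R`, the observable is bounded EXPLICITLY by `C_{i+1}/m` (`abs_transplantFn_le_of_ballFloor`); with the ground-state lower bounds of record
(quartic-∀a text, pen infvol-p2 g8; cubic Carmona–Simon rate, s1 g3) this is `C_f(R) ≤ (C_{i+1}/c)·e^{4aR⁴}` resp. `(C_{i+1}/c)·e^{a(1+√2R)³}` — the constant of the
hazard memo `W1A-HAZARD-CF.md` ∕ LEAD 19:56:52Z, now with a RATE in `R` (at the r7 floor `R = Λ^{−1/4}`: `e^{4a/Λ}`, resp. `e^{O(Λ^{−3/4})}`).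

HONEST FRAMING: fixed-lattice one-site bookkeeping (conditional femto rung R2b1); nothing here bears on infinite volume, the continuum limit or the Clay gap.
References: M. Lüscher, NPB 219 (1983) 233 [cite: Luscher1983, §2–§3]; R. Carmona, B. Simon, CMP 80 (1981) 59.
-/

set_option autoImplicit false

noncomputable section

open MeasureTheory Filter Topology Real
open Literature.Analysis.OperatorTheory.YMMatrixModel

namespace Summit.QuantumFields.YangMills.Theorems.FemtoTransferGap.PolyakovLift

open Summit.QuantumFields.YangMills.Theorems.FemtoTransferGap

variable {k : ℕ}

/-- ★ **Explicit sup from a floor on the ball**: `|χ_R f_{i+1}/f_0| ≤ C_{i+1}/m` when `|f_{i+1}| ≤ C_{i+1}` everywhere and `0 < m ≤ f_0` on `‖y‖² < 2R²`.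
[cite: Luscher1983, §2–§3] -/
theorem abs_transplantFn_le_of_ballFloor {R : ℝ} (hR : 0 < R) (f : Fin (k + 1) → ZM → ℝ) (i : Fin k) {Cf m : ℝ}
    (hCf : ∀ y, |f i.succ y| ≤ Cf) (hm : 0 < m) (hfloor : ∀ y : ZM, ‖y‖ ^ 2 < 2 * R ^ 2 → m ≤ f 0 y) (y : ZM) :
    |transplantFn R f i y| ≤ Cf / m := by
  have hCf0 : 0 ≤ Cf := (abs_nonneg _).trans (hCf y)
  unfold transplantFn
  by_cases hfar : 2 * R ^ 2 ≤ ‖y‖ ^ 2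
  · rw [radialCutoff_eq_zero hR hfar, zero_mul, abs_zero]; positivity
  · push Not at hfar
    have hf0 : m ≤ f 0 y := hfloor y hfar
    have hf0pos : 0 < f 0 y := lt_of_lt_of_le hm hf0
    have hχ := radialCutoff_mem_Icc R y
    rw [abs_mul, abs_div, abs_of_nonneg hχ.1, abs_of_pos hf0pos]
    calc radialCutoff R y * (|f i.succ y| / f 0 y) ≤ 1 * (Cf / m) :=
          mul_le_mul hχ.2 (div_le_div₀ hCf0 (hCf y) hm hf0) (by positivity) zero_le_one
      _ = Cf / m := one_mul _

/-- On the support ball, `‖y‖ ≤ √2·R`. [folklore] -/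
theorem norm_le_sqrt_two_mul_of_sq_lt {R : ℝ} (hR : 0 < R) {y : ZM} (h : ‖y‖ ^ 2 < 2 * R ^ 2) : ‖y‖ ≤ Real.sqrt 2 * R := by
  have h1 : ‖y‖ ^ 2 < (Real.sqrt 2 * R) ^ 2 := by rw [mul_pow, Real.sq_sqrt (by norm_num : (0:ℝ) ≤ 2)]; exact h
  exact (lt_of_pow_lt_pow_left₀ 2 (by positivity) h1).le

/-- ★ **Quartic floor** (the Q1 text of record, `c·e^{−a‖y‖⁴} ≤ f_0`): `|χ_R f_{i+1}/f_0| ≤ (C_{i+1}/c)·e^{4aR⁴}`. [cite: Luscher1983, §2–§3] -/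
theorem abs_transplantFn_le_of_quarticFloor {R : ℝ} (hR : 0 < R) (f : Fin (k + 1) → ZM → ℝ) (i : Fin k) {Cf c a : ℝ}
    (hCf : ∀ y, |f i.succ y| ≤ Cf) (hc : 0 < c) (ha : 0 ≤ a) (hfloor : ∀ y : ZM, c * Real.exp (-(a * ‖y‖ ^ 4)) ≤ f 0 y) (y : ZM) :
    |transplantFn R f i y| ≤ Cf / c * Real.exp (4 * a * R ^ 4) := by
  have hm : 0 < c * Real.exp (-(4 * a * R ^ 4)) := by positivity
  have h := abs_transplantFn_le_of_ballFloor hR f i hCf hm (fun z hz => ?_) y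
  · rw [Real.exp_neg] at h
    calc |transplantFn R f i y| ≤ Cf / (c * (Real.exp (4 * a * R ^ 4))⁻¹) := h
      _ = Cf / c * Real.exp (4 * a * R ^ 4) := by field_simp
  · refine le_trans (mul_le_mul_of_nonneg_left (Real.exp_le_exp.2 ?_) hc.le) (hfloor z)
    have h4 : ‖z‖ ^ 4 ≤ (2 * R ^ 2) ^ 2 := by
      rw [show ‖z‖ ^ 4 = (‖z‖ ^ 2) ^ 2 by ring]
      exact pow_le_pow_left₀ (sq_nonneg _) hz.le 2
    nlinarith

/-- ★ **Cubic floor** (Carmona–Simon rate, `c·e^{−a(1+‖y‖)³} ≤ f_0`): `|χ_R f_{i+1}/f_0| ≤ (C_{i+1}/c)·e^{a(1+√2R)³}`. [cite: Luscher1983, §2–§3] -/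
theorem abs_transplantFn_le_of_cubicFloor {R : ℝ} (hR : 0 < R) (f : Fin (k + 1) → ZM → ℝ) (i : Fin k) {Cf c a : ℝ}
    (hCf : ∀ y, |f i.succ y| ≤ Cf) (hc : 0 < c) (ha : 0 ≤ a) (hfloor : ∀ y : ZM, c * Real.exp (-(a * (1 + ‖y‖) ^ 3)) ≤ f 0 y) (y : ZM) :
    |transplantFn R f i y| ≤ Cf / c * Real.exp (a * (1 + Real.sqrt 2 * R) ^ 3) := by
  have hm : 0 < c * Real.exp (-(a * (1 + Real.sqrt 2 * R) ^ 3)) := by positivity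
  have h := abs_transplantFn_le_of_ballFloor hR f i hCf hm (fun z hz => ?_) y
  · rw [Real.exp_neg] at h
    calc |transplantFn R f i y| ≤ Cf / (c * (Real.exp (a * (1 + Real.sqrt 2 * R) ^ 3))⁻¹) := h
      _ = Cf / c * Real.exp (a * (1 + Real.sqrt 2 * R) ^ 3) := by field_simp
  · refine le_trans (mul_le_mul_of_nonneg_left (Real.exp_le_exp.2 ?_) hc.le) (hfloor z)
    have hz' := norm_le_sqrt_two_mul_of_sq_lt hR hz
    have h3 : (1 + ‖z‖) ^ 3 ≤ (1 + Real.sqrt 2 * R) ^ 3 := pow_le_pow_left₀ (by positivity) (by linarith) 3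
    nlinarith

end Summit.QuantumFields.YangMills.Theorems.FemtoTransferGap.PolyakovLift

end
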